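import Summits.QuantumFields.YangMills.Theorems.UnitScaleTiltProp7SectET3LandauOpRowsEtaT3
import Summits.QuantumFields.YangMills.Theorems.UnitScaleTiltProp7Size19Orders01T3
import Summits.QuantumFields.YangMills.Theorems.UnitScaleTiltProp7ChartDatumSplit
import Summits.QuantumFields.YangMills.Theorems.UnitScaleTiltProp7HDsolAtRecordOfRows
import HarnessLib

/-!
# Route `UnitScaleTilt`, crux «MinimiserStabilityRegPr» (stmt-QuantumFields-19200, stub EX `stub_existenceMinimalOrbit`) ∕ (O″χ) B0 (stmt-QuantumFields-20520), node N06(d = 3), route (α) —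
# **«HDSOL-ETA» (EX namer ★w2-19200 g6 22:31:58Z «px16: HDSOL-ETA GO», ★★OWNER ACK 84 (3); cure of display defect №8 `hmult`∕HMULT-127, ★px21 g2 memo 0dcf6d824fa10ff5):
# ✓p669325 `hΔsol_at_record_of_rows127` WITH THE OPERATOR-LEVEL LANDAU GUARDS `hkill`∕`horth` AND THE MULTIPLIER ROW `hmult` REPLACED BY PRINT's ROWS ABOUT THE SOLUTION — the slice rows
# `hLan`∕`hQY` ((127), (45)∕(102)) and (128) in Hilbert form `h128` with its multiplier `μ` (★px21 g2 route, ★px5 g2 OPROWS-ETA v2)** — so that the junction can be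
# instantiated at print's slot `Δx := DeltaEtaSlot` (`Δ_a = Δ^η + D R_S D* + Q*aQ`, `G = Δ_a⁻¹`, [Balaban1985BackgroundPropagators] (3.26)∕Thm 3.3), where `Δ^η(D_{U₀}λ) = 0` is FALSE off
# critical backgrounds (`⟨Dλ, Δ^η w⟩ = −⟨J(U₀), (∂_w D)λ⟩`; px16 22:28:27Z caveat, EX namer 22:31:58Z amendment): print carries the gauge part on THE SOLUTION — (127) `R(D*A′) = 0` and the
# averaging constraint `QA′ = B̃` — not on the operator.  The slot `Δx` stays GENERIC (standing instruction (D)); at `Δx := DeltaPiSlotP`∕`DeltaOnePJ` the new rows follow from the old guards by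
# ✓`RS_DstarL2_sol`∕✓`Qk_sol`, at `Δx := DeltaEtaSlot` they are print's (127)∕(45) for the chart value.

Cell `ym3-torus` (HUMAN RULING D-0037, YM ladder rung R3 — YM₃ on T³, NOT d = 4, NOT Clay; YM gap NOT proved), width seat `ym3-torus-px16` (gen 2).  THEOREMS ONLY (0 `def`, 0 `sorry`);
`--supports stmt-QuantumFields-19200 --as helper`, count-neutral.

WHAT IS PROVED (ns `…Theorems.Prop7HDsolAtRecordOfRowsEta`).  ★★★`hΔsol_at_record_of_rowsEta` — the text of ✓`hΔsol_at_record_of_rows127` VERBATIM (generic slot `{Δx}`, class `hp : PosOnto … Δx U₀`,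
letter rows `norm_G quad norm_H₁`, Prop. 6 windows `h1 h2 h3`, the four background-level operator rows `hOpC h137 hOp139 hOp349` of ★px5 g2, the displayed solution `A₁ ‖A₁‖ < r heq` —
`heq` (111) now serves ONLY Prop. 6's uniqueness∕size (116)) EXCEPT: `hkill horth hmult` DELETED; three rows about THE SOLUTION added — `hLan : R_S(D*(toL2 (ιA₁ + ι(H₁B̃)))) = 0`,
`hQY : Q_k(toL2 (ιA₁ + ι(H₁B̃))) = toL2B B̃`, `(μ) (h128 : Δx(toL2 (ιA₁ + ι(H₁B̃))) + (Ĵ + Ŵ) = Q_k† μ)`; SAME conclusion ((136)+(140) with `MΔ := (1 + 25C₄B₀²) + cC(1 + 25C₄B₀²) + 2c₁₃₇ + 5k₁₃₉B₀ + 140B₀ + 5k₃₄₉B₀ + 20B₀` times `ρη²`, `ρ = L³·3L·ε₁`).  Proof = ✓p669325's body with the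
ONE call re-pointed to ★px5 g2's ✓∕⧗`Prop7SectET3LandauOpRowsEta.secondOrder_of_eq128_opRowsEta_rho` (v2, over ★px21 g2's ✓∕⧗`Prop7Eq130OfEq128.slot_eq_of_eq128_landau`).
HONEST SCOPE.  By-name composition + the sizes (20)∕(28)∕(97)∕(116) exactly as in ✓p669325; the operator rows, `hLan`, `hQY`, `h128` (with `μ`), `heq`, `norm_G quad norm_H₁` stay DISPLAYED; which
slot S11 instantiates is the EX namer's (22:27:41Z∕22:31:58Z); not a proof of the stub; nothing continuum ∕ OS ∕ mass-gap ∕ Clay.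

References: T. Bałaban, CMP **102** (1985) 277–309 [Balaban1985Variational] ((19)–(20) p.281, (28) p.282, (45) p.285, (97) p.292, (102) p.293, (111) p.294, Prop. 6 (116) p.295, (127)–(140)
pp.297–299); CMP **99** (1985) 389–434 [Balaban1985BackgroundPropagators] ((3.26) p.395, Thm 3.3 p.396, (3.19) p.393, (3.49) p.399, (3.119)–(3.126) pp.419–420, (3.153) p.426).
-/

set_option autoImplicit false

noncomputable section

open scoped InnerProductSpace ComplexConjugate Matrix.Norms.L2Operator

namespace Summit.QuantumFields.YangMills.Theorems.Prop7HDsolAtRecordOfRowsEta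

open Literature.MathematicalPhysics.QuantumFieldTheory.Balaban1983to89
open Literature.MathematicalPhysics.QuantumFieldTheory.Balaban1983to89.T3ContinuumYM3Torus
open Literature.MathematicalPhysics.QuantumFieldTheory.Balaban1983to89.T3PrintedRegularMinimiser (RegPr)
open Literature.MathematicalPhysics.QuantumFieldTheory.Balaban1983to89.T3UnitLawDensityEML (ℰp)
open Literature.MathematicalPhysics.QuantumFieldTheory.Balaban1983to89.T3TiltDescent (descendTo)
open T3SectALandauChart (eta eta_pos covCodiffCurlT covLapFormT bgUnits CloseAvg)
open B9SectCLatticeCarrier (Bond)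
open B9Eq311L2Pairing (WL2)
open B11Eq115Space (NegSize NegSup Space115 JetSup levWeight)
open B11Eq111FrakG (nabla115)
open B11Eq103H1Complex (SiteL2K BondL2K funEquiv funEquiv_symm_apply)
open B11Eq98CurrentSlot (Jcur norm_Jcur_le)
open B13Contraction113 (QuadAnalytic)
open MatrixLog (mlog)
open Summit.QuantumFields.YangMills.Theorems.Prop7SectET3Transport (periodsT3 bondEquiv bgOfCfg isUnitaryBg_bgOfCfg levWeight_const_eq_one norm_negSize_const_eq)
open Summit.QuantumFields.YangMills.Theorems.Prop7SectET3HilbertLetters (W₂ frobEquiv toL2 toL2S toL2B DL2 DstarL2 toL2_symm_apply)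
open Summit.QuantumFields.YangMills.Theorems.Prop7SectET3GaugeProjector (NS RS)
open Summit.QuantumFields.YangMills.Theorems.Prop7SectET3WilsonHessian (DeltaEta)
open Summit.QuantumFields.YangMills.Theorems.Prop7SectET3CurvedPropagators
open Summit.QuantumFields.YangMills.Theorems.Prop7SectET3DeltaPi
open Summit.QuantumFields.YangMills.Theorems.Prop7SectET3Objects (inU2cur_bgOfCfg_of_regPr prop6_bgOfCfg)
open Summit.QuantumFields.YangMills.Theorems.Prop7Bound20SymLog (bound20_symLog_of_closeAvg)
open Summit.QuantumFields.YangMills.Theorems.Prop7HessRowOfEq111 (toL2_iota_eq111)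
open Summit.QuantumFields.YangMills.Theorems.Prop7SectET3LandauOpRowsEta (secondOrder_of_eq128_opRowsEta_rho)
open Summit.QuantumFields.YangMills.Theorems.Prop7ChartDatumSplit (norm_jetRead_le)
open Summit.QuantumFields.YangMills.Theorems.Prop7HDsolAtRecordOfRows (toL2_symm_funEquiv_symm_apply norm_negSup_equiv_apply_le norm_jetRead_apply_le)

variable {F : T3Family} {n K : ℕ} {c₀ : ℝ} [Fact (0 < c₀)]

/-! ## §2 The junction: S9's `hΔsol` member text from the four operator rows -/

set_option maxHeartbeats 400000 in
-- HEARTBEAT rule (README): the statement carries the member's full letter terms (`frakGfR`, `H1f`, the slot `Δx`, `LinearMap.adjoint (Qk …)`, `KinvT`, `GT`); the E2-133∕OP-ROWS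
-- junctions it calls measured > 200k at elaboration.
/-- ★★★ **`hΔsol` AT THE MEMBER FROM THE FOUR OPERATOR ROWS, THE CLASS `PosOnto`, AND PRINT's ROWS ABOUT THE SOLUTION `hLan hQY h128` ((127), (45), (128); NO operator-level Landau guard, NO multiplier)** — ✓`hΔsol_at_record_of_rows127`'s
text with `hkill horth hmult ↦ hLan hQY (μ) h128`; generic slot `Δx` (instantiable at `DeltaEtaSlot` = print's `Δ_a`-slot as well as at the pinv letters); ONE call of ★px5's `secondOrder_of_eq128_opRowsEta_rho`
at `cx := 1 + 25·C₄·B₀²`, `cb := 2`, `B₁ := 10·B₀`.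
[cite: Balaban1985Variational, (127)–(136) pp.297–298, (140) p.299, (111) p.294, Prop. 6 p.295, (45) p.285, (102) p.293, (19)–(20) p.281; Balaban1985BackgroundPropagators, (3.26) p.395, Thm 3.3 p.396, (3.19) p.393, (3.49) p.399, (3.153) p.426] -/
theorem hΔsol_at_record_of_rowsEta (F : T3Family) (n K : ℕ) (h : n ≤ K) [Fact (0 < (F.L : ℝ))] [Fact (0 < ((F.L : ℝ)⁻¹) ^ (K - n))]
    {c₀ cB a : ℝ} [Fact (0 < c₀)] [Fact (0 < cB)]
    -- THE HESSIAN SLOT, GENERIC (★w2-19200 g6 standing instruction (D): `Δx` + slot rows, never `hq : PosPrime`)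
    {Δx : GaugeField (F.P K) 0 (Matrix.specialUnitaryGroup (Fin 2) ℂ) → (BondL2K ℂ 3 (periodsT3 F K) c₀ W₂ →ₗ[ℂ] BondL2K ℂ 3 (periodsT3 F K) c₀ W₂)}
    (U₀ : GaugeField (F.P K) 0 (Matrix.specialUnitaryGroup (Fin 2) ℂ)) (V : GaugeField (F.P n) 0 (Matrix.specialUnitaryGroup (Fin 2) ℂ))
    -- the ONE opaque letter of the knit, print's `(δ∕δA′)V`, in S9's `Wf L i U₀` type
    (W : Space115 (F.L : ℝ) (((F.L : ℝ)⁻¹) ^ (K - n)) (fun _ : Bond 3 (periodsT3 F K) => K - n) (fun _ : Bond 3 (periodsT3 F K) × Fin 3 => K - n)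
            (nabla115 (((F.L : ℝ)⁻¹) ^ (K - n)) (bgOfCfg F K U₀)) →
          NegSize (F.L : ℝ) (((F.L : ℝ)⁻¹) ^ (K - n)) (fun _ : Bond 3 (periodsT3 F K) => K - n) 3 (Matrix (Fin 2) (Fin 2) ℂ))
    {B₀ C₄ a₃ r ε₁ cC c137 k139 k349 : ℝ} (hB₀ : 0 < B₀) (hC₄ : 0 < C₄) (hε₁ : 0 < ε₁)
    -- the prefix of S9's `hΔsol` at the member (+ the two numerals the knit derives from `ρ ≤ α ≤ 10⁻¹²L⁻³`)
    (hreg : RegPr F n K ((F.L : ℝ) ^ 3 * (3 * (F.L : ℝ)) * ε₁) U₀) (hclose : CloseAvg F n K h ((F.L : ℝ) ^ 3 * ε₁) V U₀)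
    (hwin : (F.L : ℝ) ^ 3 * ε₁ ≤ 1 / 2) (hρ1 : (F.L : ℝ) ^ 3 * (3 * (F.L : ℝ)) * ε₁ ≤ 1)
    -- the class at this background ([5] Thm 3.3 + (3.19): `Δ_a := Δx + DR_SD* + Q*aQ` positive and `Q_k` onto) — NO operator-level Landau guard (`hkill`∕`horth` RETIRED, EX namer 22:31:58Z)
    (hp : PosOnto F n K h c₀ cB a Δx U₀)
    -- the knit's letter rows AT THE LETTERS OF RECORD (`norm_G` at `frakGfR …Δ_π…`, `prop4`'s size clause at the opaque `W`, `norm_H₁` at `H1f …Δ_π…`)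
    (norm_G : ∀ f, ‖frakGfR F n K h c₀ cB a Δx U₀ f‖ ≤ B₀ * ‖f‖) (quad : QuadAnalytic W C₄ a₃)
    (norm_H₁ : ∀ b, ‖H1f F n K h c₀ cB a Δx U₀ b‖ ≤ B₀ * ‖b‖)
    -- Prop. 6's windows in its own letters (`ε₄ := r`, `C₁ := L³`, `B₃ := 3L`)
    (h1 : 2 * B₀ * (F.L : ℝ) ^ 3 * (3 * (F.L : ℝ)) * ε₁ ≤ r) (h2 : 4 * r ≤ a₃) (h3 : 16 * B₀ * C₄ * r ≤ 1)
    -- THE FOUR DISPLAYED BACKGROUND-LEVEL ROWS (★px5 g2 «OP-ROWS-127» texts BYTE-EXACT: tube-only `hOpC′`, generic-`Y` `h137`, slot-defect `hOp139′`, `hOp349`)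
    (hOpC : ∀ (x : BondL2K ℂ 3 (periodsT3 F K) c₀ W₂) (bd : PBond (F.P K) 0),
      ‖(toL2 F K c₀).symm (LinearMap.adjoint (Qk F n K h c₀ cB U₀) (KinvT F n K h c₀ cB a Δx U₀ (Qk F n K h c₀ cB U₀ (GT F n K h c₀ cB a Δx U₀ x)))) bd‖
        ≤ cC * ‖(toL2 F K c₀).symm x‖)
    (h137 : ∀ (Y : PBond (F.P n) 0 → Matrix (Fin 2) (Fin 2) ℂ) (b : PBond (F.P K) 0),
      ‖(toL2 F K c₀).symm (LinearMap.adjoint (Qk F n K h c₀ cB U₀) (KinvT F n K h c₀ cB a Δx U₀ (toL2B F n cB Y))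
          - LinearMap.adjoint (Qk F n K h c₀ cB U₀) (((a : ℂ)) • toL2B F n cB Y)) b‖ ≤ c137 * ‖Y‖)
    (hOp139 : ∀ (X : PBond (F.P K) 0 → Matrix (Fin 2) (Fin 2) ℂ) (s : ℝ), RS F n K h c₀ cB U₀ (DstarL2 F n K c₀ U₀ (toL2 F K c₀ X)) = 0 → (∀ bd, ‖X bd‖ ≤ s) →
      ∀ bd : PBond (F.P K) 0, ‖(toL2 F K c₀).symm (DeltaEta F n K c₀ U₀ (toL2 F K c₀ X) - Δx U₀ (toL2 F K c₀ X)) bd‖ ≤ k139 * s)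
    (hOp349 : ∀ (X : PBond (F.P K) 0 → Matrix (Fin 2) (Fin 2) ℂ) (s : ℝ), (∀ bd, ‖X bd‖ ≤ s) → ∀ bd : PBond (F.P K) 0,
      ‖(toL2 F K c₀).symm (DL2 F n K c₀ U₀ (DstarL2 F n K c₀ U₀ (toL2 F K c₀ X) - RS F n K h c₀ cB U₀ (DstarL2 F n K c₀ U₀ (toL2 F K c₀ X)))) bd‖ ≤ k349 * s)
    -- the displayed solution of (111) (S9's `A₁`, `‖A₁‖ < r L`, `heq` text at the letters of record)
    (A₁ : Space115 (F.L : ℝ) (((F.L : ℝ)⁻¹) ^ (K - n)) (fun _ : Bond 3 (periodsT3 F K) => K - n) (fun _ : Bond 3 (periodsT3 F K) × Fin 3 => K - n)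
      (nabla115 (((F.L : ℝ)⁻¹) ^ (K - n)) (bgOfCfg F K U₀)))
    (hA₁ : ‖A₁‖ < r)
    (heq : A₁ + frakGfR F n K h c₀ cB a Δx U₀ (Jcur (bgOfCfg F K U₀))
        + frakGfR F n K h c₀ cB a Δx U₀ (W (A₁ + H1f F n K h c₀ cB a Δx U₀ (fun c : PBond (F.P n) 0 =>
          (-Complex.I) • mlog (((V c : Matrix.specialUnitaryGroup (Fin 2) ℂ) : Matrix (Fin 2) (Fin 2) ℂ)
            * star ((descendTo F ℰp n K h U₀ c : Matrix.specialUnitaryGroup (Fin 2) ℂ) : Matrix (Fin 2) (Fin 2) ℂ))))) = 0)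
    -- THE SOLUTION's SLICE ROWS (print's mechanism at the `Δ_a`-slot, replacing the operator guards): (127)∕(102)L `R_S D*(ιA₁ + ι(H₁B̃)) = 0` (the chart value is Landau —
    -- conjunct (i) of `hSplit′`∕`IsLandauPrintS`) and (45)∕(102) `Q_k(ιA₁ + ι(H₁B̃)) = B̃` (the averaging constraint of the chart), in brick L0a's `L²` letters (★px5 ✓∕⧗`…LandauOpRowsEtaT3`'s `hLan hQY`)
    (hLan : RS F n K h c₀ cB U₀ (DstarL2 F n K c₀ U₀ (toL2 F K c₀ ((fun b : PBond (F.P K) 0 => JetSup.equiv _ _ _ A₁ (bondEquiv F K b))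
        + (fun b : PBond (F.P K) 0 => JetSup.equiv _ _ _ (H1f F n K h c₀ cB a Δx U₀ (fun c : PBond (F.P n) 0 =>
          (-Complex.I) • mlog (((V c : Matrix.specialUnitaryGroup (Fin 2) ℂ) : Matrix (Fin 2) (Fin 2) ℂ)
            * star ((descendTo F ℰp n K h U₀ c : Matrix.specialUnitaryGroup (Fin 2) ℂ) : Matrix (Fin 2) (Fin 2) ℂ)))) (bondEquiv F K b))))) = 0)
    (hQY : Qk F n K h c₀ cB U₀ (toL2 F K c₀ ((fun b : PBond (F.P K) 0 => JetSup.equiv _ _ _ A₁ (bondEquiv F K b))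
        + (fun b : PBond (F.P K) 0 => JetSup.equiv _ _ _ (H1f F n K h c₀ cB a Δx U₀ (fun c : PBond (F.P n) 0 =>
          (-Complex.I) • mlog (((V c : Matrix.specialUnitaryGroup (Fin 2) ℂ) : Matrix (Fin 2) (Fin 2) ℂ)
            * star ((descendTo F ℰp n K h U₀ c : Matrix.specialUnitaryGroup (Fin 2) ℂ) : Matrix (Fin 2) (Fin 2) ℂ)))) (bondEquiv F K b)))) = toL2B F n cB (fun c : PBond (F.P n) 0 =>
          (-Complex.I) • mlog (((V c : Matrix.specialUnitaryGroup (Fin 2) ℂ) : Matrix (Fin 2) (Fin 2) ℂ)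
            * star ((descendTo F ℰp n K h U₀ c : Matrix.specialUnitaryGroup (Fin 2) ℂ) : Matrix (Fin 2) (Fin 2) ℂ))))
    -- PRINT's (128) FOR THE SOLUTION, HILBERT FORM (★px21's display text, ★px5 v2's `h128`): `Δx(ιA₁ + ι(H₁B̃)) + (Ĵ + Ŵ) ∈ range Q_k†`, with its multiplier `μ` DISPLAYED —
    -- the derivative of the reparametrised action vanishes on `ker Q` ([Balaban1985Variational] (127)–(128) p.297); NO `R_S`-multiplier, NO (3.124), NO (111)-reader at this junction
    (μ : WL2 ℂ (fun _ : PBond (F.P n) 0 => cB) W₂)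
    (h128 : Δx U₀ (toL2 F K c₀ ((fun b : PBond (F.P K) 0 => JetSup.equiv _ _ _ A₁ (bondEquiv F K b))
        + (fun b : PBond (F.P K) 0 => JetSup.equiv _ _ _ (H1f F n K h c₀ cB a Δx U₀ (fun c : PBond (F.P n) 0 =>
          (-Complex.I) • mlog (((V c : Matrix.specialUnitaryGroup (Fin 2) ℂ) : Matrix (Fin 2) (Fin 2) ℂ)
            * star ((descendTo F ℰp n K h U₀ c : Matrix.specialUnitaryGroup (Fin 2) ℂ) : Matrix (Fin 2) (Fin 2) ℂ)))) (bondEquiv F K b))))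
        + ((funEquiv frobEquiv (fun _ : Bond 3 (periodsT3 F K) => c₀)).symm
        (NegSup.equiv _ _ (Jcur (L := (F.L : ℝ)) (η := ((F.L : ℝ)⁻¹) ^ (K - n)) (lev₀ := fun _ : Bond 3 (periodsT3 F K) => K - n) (bgOfCfg F K U₀))
          + NegSup.equiv _ _ (W (A₁ + H1f F n K h c₀ cB a Δx U₀ (fun c : PBond (F.P n) 0 =>
          (-Complex.I) • mlog (((V c : Matrix.specialUnitaryGroup (Fin 2) ℂ) : Matrix (Fin 2) (Fin 2) ℂ)
            * star ((descendTo F ℰp n K h U₀ c : Matrix.specialUnitaryGroup (Fin 2) ℂ) : Matrix (Fin 2) (Fin 2) ℂ))))))) = LinearMap.adjoint (Qk F n K h c₀ cB U₀) μ) :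
    (∀ (μ : Fin (F.P K).d) (x : Site (F.P K) 0),
        ‖covCodiffCurlT 1 (bgUnits F K U₀) ((fun b : PBond (F.P K) 0 => JetSup.equiv _ _ _ A₁ (bondEquiv F K b))
        + (fun b : PBond (F.P K) 0 => JetSup.equiv _ _ _ (H1f F n K h c₀ cB a Δx U₀ (fun c : PBond (F.P n) 0 =>
          (-Complex.I) • mlog (((V c : Matrix.specialUnitaryGroup (Fin 2) ℂ) : Matrix (Fin 2) (Fin 2) ℂ)
            * star ((descendTo F ℰp n K h U₀ c : Matrix.specialUnitaryGroup (Fin 2) ℂ) : Matrix (Fin 2) (Fin 2) ℂ)))) (bondEquiv F K b))) μ x‖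
          ≤ ((1 + 25 * C₄ * B₀ ^ 2) + cC * (1 + 25 * C₄ * B₀ ^ 2) + c137 * 2 + k139 * (10 * B₀) / 2 + 14 * (10 * B₀) + k349 * (10 * B₀) / 2 + 2 * (10 * B₀))
            * ((F.L : ℝ) ^ 3 * (3 * (F.L : ℝ)) * ε₁) * eta F n K ^ 2) ∧
      (∀ (ν : Fin (F.P K).d) (x : Site (F.P K) 0),
        ‖covLapFormT 1 (bgUnits F K U₀) ((fun b : PBond (F.P K) 0 => JetSup.equiv _ _ _ A₁ (bondEquiv F K b))
        + (fun b : PBond (F.P K) 0 => JetSup.equiv _ _ _ (H1f F n K h c₀ cB a Δx U₀ (fun c : PBond (F.P n) 0 =>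
          (-Complex.I) • mlog (((V c : Matrix.specialUnitaryGroup (Fin 2) ℂ) : Matrix (Fin 2) (Fin 2) ℂ)
            * star ((descendTo F ℰp n K h U₀ c : Matrix.specialUnitaryGroup (Fin 2) ℂ) : Matrix (Fin 2) (Fin 2) ℂ)))) (bondEquiv F K b))) ν x‖
          ≤ ((1 + 25 * C₄ * B₀ ^ 2) + cC * (1 + 25 * C₄ * B₀ ^ 2) + c137 * 2 + k139 * (10 * B₀) / 2 + 14 * (10 * B₀) + k349 * (10 * B₀) / 2 + 2 * (10 * B₀))
            * ((F.L : ℝ) ^ 3 * (3 * (F.L : ℝ)) * ε₁) * eta F n K ^ 2) := by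
  have hL : 0 < (F.L : ℝ) := Fact.out
  set ρ : ℝ := (F.L : ℝ) ^ 3 * (3 * (F.L : ℝ)) * ε₁ with hρdef
  have hρ : 0 < ρ := by positivity
  -- the datum `B̃` and (20): `‖B̃‖ < 2·3L·(L³ε₁) = 2ρ`
  set Bt : PBond (F.P n) 0 → Matrix (Fin 2) (Fin 2) ℂ := fun c : PBond (F.P n) 0 =>
    (-Complex.I) • mlog (((V c : Matrix.specialUnitaryGroup (Fin 2) ℂ) : Matrix (Fin 2) (Fin 2) ℂ)
      * star ((descendTo F ℰp n K h U₀ c : Matrix.specialUnitaryGroup (Fin 2) ℂ) : Matrix (Fin 2) (Fin 2) ℂ)) with hBtdef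
  have hBt : ‖Bt‖ < 2 * ((3 : ℝ) * F.L) * ((F.L : ℝ) ^ 3 * ε₁) := bound20_symLog_of_closeAvg F h hε₁ hwin V U₀ hclose
  have h2ρ : 2 * ((3 : ℝ) * F.L) * ((F.L : ℝ) ^ 3 * ε₁) = 2 * ρ := by rw [hρdef]; ring
  have hBt' : ‖Bt‖ ≤ 2 * ρ := by rw [← h2ρ]; exact hBt.le
  -- the letters of record, abbreviated
  set 𝒢 := frakGfR F n K h c₀ cB a Δx U₀ with h𝒢def
  set H₁ := H1f F n K h c₀ cB a Δx U₀ with hH₁def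
  -- (103)∕(117): `‖H₁B̃‖ ≤ B₀‖B̃‖ < 2B₀ρ`
  have h𝔄 : ‖H₁ Bt‖ < 2 * ((3 : ℝ) * F.L) * B₀ * (F.L : ℝ) ^ 3 * ε₁ := by
    calc ‖H₁ Bt‖ ≤ B₀ * ‖Bt‖ := norm_H₁ Bt
      _ < B₀ * (2 * ((3 : ℝ) * F.L) * ((F.L : ℝ) ^ 3 * ε₁)) := mul_lt_mul_of_pos_left hBt hB₀
      _ = 2 * ((3 : ℝ) * F.L) * B₀ * (F.L : ℝ) ^ 3 * ε₁ := by ring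
  have h𝔄' : ‖H₁ Bt‖ ≤ 2 * B₀ * ρ := by
    calc ‖H₁ Bt‖ ≤ B₀ * ‖Bt‖ := norm_H₁ Bt
      _ ≤ B₀ * (2 * ρ) := mul_le_mul_of_nonneg_left hBt' hB₀.le
      _ = 2 * B₀ * ρ := by ring
  -- Prop. 6 (116): the displayed solution IS the unique one, of size `< 3B₀ρ`
  obtain ⟨A, -, -, hAsize, huniq⟩ := prop6_bgOfCfg F K n U₀ (𝒢 := 𝒢) (W := W) norm_G quad hB₀ hC₄ (by positivity : (0 : ℝ) < (F.L : ℝ) ^ 3)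
    (by positivity : (0 : ℝ) < 3 * (F.L : ℝ)) hε₁ (le_refl _) h1 h2 h3 hreg (𝔄 := H₁ Bt) h𝔄
  have hA₁eq : A₁ = A := huniq A₁ hA₁ heq
  have hA₁size : ‖A₁‖ < 3 * B₀ * ρ := by
    rw [hA₁eq]; calc ‖A‖ < 3 * B₀ * (F.L : ℝ) ^ 3 * (3 * (F.L : ℝ)) * ε₁ := hAsize
      _ = 3 * B₀ * ρ := by rw [hρdef]; ring
  have hsum : ‖A₁ + H₁ Bt‖ ≤ 5 * B₀ * ρ := by
    calc ‖A₁ + H₁ Bt‖ ≤ ‖A₁‖ + ‖H₁ Bt‖ := norm_add_le _ _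
      _ ≤ 3 * B₀ * ρ + 2 * B₀ * ρ := add_le_add hA₁size.le h𝔄'
      _ = 5 * B₀ * ρ := by ring
  -- (97): `‖W(A₁ + H₁B̃)‖ ≤ C₄‖A₁ + H₁B̃‖² ≤ 25C₄B₀²ρ` (the argument is in the ball `a₃` by the windows `h1 h2`)
  have hball : ‖A₁ + H₁ Bt‖ < a₃ := by
    have : 5 * B₀ * ρ < a₃ := by rw [hρdef]; nlinarith [mul_pos hB₀ hρ]
    exact hsum.trans_lt this
  have hW : ‖W (A₁ + H₁ Bt)‖ ≤ 25 * C₄ * B₀ ^ 2 * ρ := by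
    calc ‖W (A₁ + H₁ Bt)‖ ≤ C₄ * ‖A₁ + H₁ Bt‖ ^ 2 := quad.quad _ hball
      _ ≤ C₄ * (5 * B₀ * ρ) ^ 2 := mul_le_mul_of_nonneg_left (pow_le_pow_left₀ (norm_nonneg _) hsum 2) hC₄.le
      _ = 25 * C₄ * B₀ ^ 2 * ρ * ρ := by ring
      _ ≤ 25 * C₄ * B₀ ^ 2 * ρ * 1 := mul_le_mul_of_nonneg_left hρ1 (by positivity)
      _ = 25 * C₄ * B₀ ^ 2 * ρ := by ring
  -- (28): `‖J‖ ≤ C₁B₃ε₁ = ρ`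
  have hJ : ‖Jcur (L := (F.L : ℝ)) (η := ((F.L : ℝ)⁻¹) ^ (K - n)) (lev₀ := fun _ : Bond 3 (periodsT3 F K) => K - n) (bgOfCfg F K U₀)‖ ≤ ρ :=
    norm_Jcur_le (L := (F.L : ℝ)) (η := ((F.L : ℝ)⁻¹) ^ (K - n)) (lev₀ := fun _ : Bond 3 (periodsT3 F K) => K - n) _ (isUnitaryBg_bgOfCfg F K U₀)
      (by positivity) (inU2cur_bgOfCfg_of_regPr (F := F) (K := K) n U₀ hreg)
  -- the source `x = Ĵ + Ŵ` and the (115)-piece `Yf = ιA₁ + ι(H₁B̃)` as letters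
  set x : BondL2K ℂ 3 (periodsT3 F K) c₀ W₂ := (funEquiv frobEquiv (fun _ : Bond 3 (periodsT3 F K) => c₀)).symm
    (NegSup.equiv _ _ (Jcur (bgOfCfg F K U₀)) + NegSup.equiv _ _ (W (A₁ + H₁ Bt))) with hxdef
  set Yf : PBond (F.P K) 0 → Matrix (Fin 2) (Fin 2) ℂ := (fun b : PBond (F.P K) 0 => JetSup.equiv _ _ _ A₁ (bondEquiv F K b))
    + (fun b : PBond (F.P K) 0 => JetSup.equiv _ _ _ (H₁ Bt) (bondEquiv F K b)) with hYfdef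
  -- sizes: `nY := 5B₀ρ`, `sx := (1 + 25C₄B₀²)ρ`, `sb := 2ρ`
  have hYsup : ∀ bd, ‖Yf bd‖ ≤ 5 * B₀ * ρ := by
    intro bd
    rw [hYfdef, Pi.add_apply]
    calc ‖JetSup.equiv _ _ _ A₁ (bondEquiv F K bd) + JetSup.equiv _ _ _ (H₁ Bt) (bondEquiv F K bd)‖
        ≤ ‖JetSup.equiv _ _ _ A₁ (bondEquiv F K bd)‖ + ‖JetSup.equiv _ _ _ (H₁ Bt) (bondEquiv F K bd)‖ := norm_add_le _ _
      _ ≤ ‖A₁‖ + ‖H₁ Bt‖ := add_le_add (norm_jetRead_apply_le A₁ bd) (norm_jetRead_apply_le (H₁ Bt) bd)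
      _ ≤ 3 * B₀ * ρ + 2 * B₀ * ρ := add_le_add hA₁size.le h𝔄'
      _ = 5 * B₀ * ρ := by ring
  have hnY : 5 * B₀ * ρ ≤ 10 * B₀ / 2 * ρ := by linarith
  have hx : ∀ bd, ‖(toL2 F K c₀).symm x bd‖ ≤ (1 + 25 * C₄ * B₀ ^ 2) * ρ := by
    intro bd
    rw [hxdef, toL2_symm_funEquiv_symm_apply, Pi.add_apply]
    calc ‖NegSup.equiv _ _ (Jcur (bgOfCfg F K U₀)) (bondEquiv F K bd) + NegSup.equiv _ _ (W (A₁ + H₁ Bt)) (bondEquiv F K bd)‖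
        ≤ ‖NegSup.equiv _ _ (Jcur (bgOfCfg F K U₀)) (bondEquiv F K bd)‖ + ‖NegSup.equiv _ _ (W (A₁ + H₁ Bt)) (bondEquiv F K bd)‖ := norm_add_le _ _
      _ ≤ ‖Jcur (L := (F.L : ℝ)) (η := ((F.L : ℝ)⁻¹) ^ (K - n)) (lev₀ := fun _ : Bond 3 (periodsT3 F K) => K - n) (bgOfCfg F K U₀)‖ + ‖W (A₁ + H₁ Bt)‖ :=
          add_le_add (norm_negSup_equiv_apply_le _ _) (norm_negSup_equiv_apply_le _ _)
      _ ≤ ρ + 25 * C₄ * B₀ ^ 2 * ρ := add_le_add hJ hW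
      _ = (1 + 25 * C₄ * B₀ ^ 2) * ρ := by ring
  -- ONE call to ★px5's `Δ^η`-ready (127)+(128) junction (slice rows + (128) of the solution; no operator guard, no multiplier) with the four operator rows
  have hb' : ∀ c : PBond (F.P n) 0, ‖Bt c‖ ≤ 2 * ρ := fun c => (norm_le_pi_norm Bt c).trans hBt'
  have hmain := secondOrder_of_eq128_opRowsEta_rho (cx := 1 + 25 * C₄ * B₀ ^ 2) (cb := 2) (B₁ := 10 * B₀) hρ.le hρ1 hreg hp x Bt μ Yf hLan hQY h128
    hYsup hnY hx le_rfl hb' le_rfl hOpC h137 hOp139 hOp349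
  simpa only [hYfdef, hH₁def, hBtdef] using hmain

end Summit.QuantumFields.YangMills.Theorems.Prop7HDsolAtRecordOfRowsEta

end
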